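import Summits.BirchSwinnertonDyer.BirchSwinnertonDyer.Theses.LeadingTerm
import Literature.NumberTheory.EllipticCurves.KatoRankBoundSelmerProofs

/-!
# Route LeadingTerm — support item `KatoCorankBound` (stmt-BirchSwinnertonDyer-18048):
# Kato's Selmer-corank bound as a corollary of the crux `KatoDivisibility`

`Summit.BirchSwinnertonDyer.BirchSwinnertonDyer.Theses.LeadingTerm.KatoCorankBound`: for `E/ℚ`
(globally minimal `W`), an odd prime `p` of good ordinary reduction and the newform `f` of `E`,
`corank_{ℤ_p} Sel_{p^∞}(E/ℚ) ≤ ord_{T=0} L_p(f, α_p, T)` in `ℕ∞`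
(`L_p = padicLFunction f (unitRoot W p)`). In print this is K. Kato, Astérisque 295 (2004),
Thm 18.4 (p. 281), non-exceptional clause, `k = 2`, `K = ℚ`; its one printed proof is Kato's
divisibility Thm 17.4 (1)–(2) (Beilinson–Kato Euler system), which route LeadingTerm carries as
the crux `KatoDivisibility` (stmt-BirchSwinnertonDyer-18082).

This file records, sorry-free, exactly what the item reduces to, so that it closes by ONE line
the moment the crux does:

* `leadingTerm_katoCorankBound_of_thm17_4` — the item from conclusions (1)–(2) of Kato's Thm 17.4
  on ONE cyclotomic datum per `(E, p, f)`: `X(E/ℚ_∞)` is `Λ`-torsion and `p^n L_p = ι g` for some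
  `g ∈ char_Λ X(E/ℚ_∞)`. Proof (all tree THEOREMS): `corank Sel_{p^∞}(E/ℚ) ≤ rank_{ℤ_p} X/TX`
  (`WeierstrassCurve.selmerCorank_le_coinvariantsRank`, Greenberg LNM 1716 Lemma 3.1 + p. 65;
  finite generation of `X` over `Λ` by `SelmerDualData.module_finite_of_isCyclotomic`),
  `rank_{ℤ_p} X/TX ≤ ord_T g` (`IwasawaAlgebra.coinvariantsRank_le_order_of_mem_charIdeal`, the
  structure-theorem inequality) and `ord_T g ≤ ord_T ι g = ord_T (p^n L_p) = ord_T L_p`.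
* `leadingTerm_katoCorankBound_of_katoDivisibility` — IN-ROUTE GLUE: the crux `KatoDivisibility`
  (stmt-18082) implies the item, by instantiating it on the cyclotomic datum of
  `exists_isCyclotomic_isTopGenerator_isCyclotomicVariable_holds` and the dual datum of
  `WeierstrassCurve.nonempty_selmerDualData_holds`. Once `KatoDivisibility_holds` is appended to
  the route file, `KatoCorankBound` is `leadingTerm_katoCorankBound_of_katoDivisibility
  KatoDivisibility_holds`.
* `leadingTerm_katoCorankBound_of_kato_divisibility` — the same from the ∀-closure of the
  Literature named fact `kato_divisibility` (Thm 17.4 with the integral refinement (3), unused),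
  through the tree theorem `kato_selmerCorank_le_order_padicLFunction_of_kato_divisibility`.
* `leadingTerm_katoCorankBound_iff_forall_kato_selmerCorank_le_order_padicLFunction` — the item
  is, binder for binder, the universal closure over `(W, p, N, f)` of the Literature named fact
  `kato_selmerCorank_le_order_padicLFunction` (`KatoRankBound.lean`).
* `leadingTerm_padicOrderKatoSideR2_of_katoCorankBound` — the item implies the route's rank-form
  support `PAdicOrderKatoSideR2` (stmt-BirchSwinnertonDyer-0491, Kato's "In particular") by the
  PROVED Kummer corank identity `corank Sel_{p^∞}(E/ℚ) = rank E(ℚ) + corank Ш[p^∞]`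
  (`WeierstrassCurve.selmerCorank_eq_mordellWeilRank_add_holds`): one Kato seat serves both.

The first three are CONDITIONAL renderings (on Kato Thm 17.4 (1)–(2) in three spellings); none
closes the item, which stays open until stmt-18082 (`KatoDivisibility`) is proved.
-/

-- D-0017: single-problem summit, so `Summit.BirchSwinnertonDyer.BirchSwinnertonDyer.…` repeats a
-- namespace BY DESIGN (the `Summits` lib sets this option in `lakefile.toml`; repeated for standalone checks).
set_option linter.dupNamespace false

namespace Summit.BirchSwinnertonDyer.BirchSwinnertonDyer.Theorems

open scoped MatrixGroups ModularForm
open CongruenceSubgroup Literature.NumberTheory.EllipticCurves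
  Literature.NumberTheory.EllipticCurves.ModularForms
open Summit.BirchSwinnertonDyer.BirchSwinnertonDyer.Theses.LeadingTerm

/-- **`KatoCorankBound` from Kato's Thm 17.4 (1)–(2) on one cyclotomic datum.** Suppose that for
every elliptic `E/ℚ` (globally minimal `W`), every odd good ordinary prime `p` and every newform
`f` of `E` there are a cyclotomic `ℤ_p`-extension `κ` of `ℚ`, a topological generator `γ` of
`Γ = Gal(ℚ_∞/ℚ)` and a Pontryagin-dual datum `D` for `Sel_{p^∞}(E/ℚ_∞)` such that `D.X` is
`Λ`-torsion and `p^n L_p(f, α_p, T) = ι g` for some `n` and some `g ∈ char_Λ D.X` (K. Kato,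
Astérisque 295 (2004), Thm 17.4 (1)–(2), p. 273, for `T = T_pE(-1)`). Then
`corank_{ℤ_p} Sel_{p^∞}(E/ℚ) ≤ ord_{T=0} L_p` at every odd good ordinary prime, i.e. the route
decl `KatoCorankBound` holds: `corank Sel ≤ rank_{ℤ_p} X/TX`
(`WeierstrassCurve.selmerCorank_le_coinvariantsRank`, Greenberg LNM 1716 Lemma 3.1 and p. 65, with
`X` finitely generated over `Λ` by `SelmerDualData.module_finite_of_isCyclotomic`),
`rank_{ℤ_p} X/TX ≤ ord_T g` (`IwasawaAlgebra.coinvariantsRank_le_order_of_mem_charIdeal`) and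
`ord_T g ≤ ord_T ι g = ord_T (p^n L_p) = ord_T L_p`. CONDITIONAL on that hypothesis (Kato §18.5–18.10).
[cite: Kato2004, Thm 17.4 (p. 273) and Thm 18.4 (p. 281)] -/
theorem leadingTerm_katoCorankBound_of_thm17_4
    (h : ∀ (W : WeierstrassCurve ℚ) [W.IsElliptic] [W.IsGloballyMinimal] (p : ℕ) [Fact p.Prime]
      {N : ℕ} [NeZero N] (f : CuspForm (Gamma0 N) 2),
      p ≠ 2 → IsOrdinaryAt W p → IsNewformOf W f →
        ∃ (κ : ZpExtension ℚ p) (γ : Field.absoluteGaloisGroup ℚ) (D : W.SelmerDualData κ γ),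
          κ.IsCyclotomic ∧ κ.IsTopGenerator γ ∧ D.IsTorsion ∧
          ∃ (n : ℕ) (g : IwasawaAlgebra p), g ∈ D.charIdeal ∧
            iwasawaToPowerSeries p g =
              PowerSeries.C ((p : ℚ_[p]) ^ n) * padicLFunction f (unitRoot W p : ℚ_[p])) :
    KatoCorankBound := by
  intro W _ _ p _ hp hord N _ f hf
  obtain ⟨κ, γ, D, hκ, hγ, htors, n, g, hg, hιg⟩ := h W p f hp hord hf
  haveI : Module.Finite (IwasawaAlgebra p) D.X := D.module_finite_of_isCyclotomic W κ hκ hγ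
  -- `corank Sel ≤ rank X/TX ≤ ord g`
  have h0 : (W.selmerCorank p : ℕ∞) ≤ (IwasawaAlgebra.coinvariantsRank p D.X : ℕ∞) := by
    exact_mod_cast W.selmerCorank_le_coinvariantsRank hγ D
  have h1 : (W.selmerCorank p : ℕ∞) ≤ PowerSeries.order g :=
    h0.trans (IwasawaAlgebra.coinvariantsRank_le_order_of_mem_charIdeal D.X htors g hg)
  -- `ord g ≤ ord (ι g)` (coefficientwise `ℤ_p → ℚ_p`)
  have h2 : PowerSeries.order g ≤ PowerSeries.order (iwasawaToPowerSeries p g) :=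
    PowerSeries.le_order_map _
  -- `ord (ι g) = ord (p^n L_p) = ord L_p`
  have hpn : IsUnit (PowerSeries.C ((p : ℚ_[p]) ^ n)) := by
    refine IsUnit.map PowerSeries.C (IsUnit.mk0 _ (pow_ne_zero n ?_))
    exact_mod_cast (Fact.out : p.Prime).ne_zero
  have h3 : PowerSeries.order (iwasawaToPowerSeries p g) =
      PowerSeries.order (padicLFunction f (unitRoot W p : ℚ_[p])) := by
    rw [hιg, PowerSeries.order_mul, PowerSeries.order_zero_of_unit hpn, zero_add]
  exact h3 ▸ h1.trans h2

/-- **In-route glue: the crux `KatoDivisibility` (stmt-BirchSwinnertonDyer-18082) implies the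
support item `KatoCorankBound` (stmt-BirchSwinnertonDyer-18048).** `KatoDivisibility` asserts Kato's
Thm 17.4 (1)–(2) for EVERY cyclotomic datum `(κ, γ)` matching the variable `T` of `L_p` and every
Pontryagin-dual datum `D`; instantiate it on the cyclotomic datum of the tree theorem
`exists_isCyclotomic_isTopGenerator_isCyclotomicVariable_holds` (`κ_cyc = ℓ ∘ χ_p`,
`χ_p(γ) = 1 + p`) and the dual datum of `WeierstrassCurve.nonempty_selmerDualData_holds`, and apply
`leadingTerm_katoCorankBound_of_thm17_4`. When `KatoDivisibility_holds` lands in the route file,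
`KatoCorankBound` follows as `leadingTerm_katoCorankBound_of_katoDivisibility KatoDivisibility_holds`.
CONDITIONAL on the open crux. [cite: Kato2004, Thm 17.4 (p. 273) and Thm 18.4 (p. 281)] -/
theorem leadingTerm_katoCorankBound_of_katoDivisibility (h : KatoDivisibility) : KatoCorankBound := by
  refine leadingTerm_katoCorankBound_of_thm17_4 fun W _ _ p _ N _ f hp hord hf => ?_
  obtain ⟨κ, hκ, γ, hγ, hγ'⟩ := exists_isCyclotomic_isTopGenerator_isCyclotomicVariable_holds p
  obtain ⟨D⟩ := W.nonempty_selmerDualData_holds κ γ hγ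
  obtain ⟨htors, n, g, hg, hιg⟩ := h W p hp hord κ γ hκ hγ hγ' f hf D
  exact ⟨κ, γ, D, hκ, hγ, htors, n, g, hg, hιg⟩

/-- **The item is the universal closure of the Literature named fact.** `KatoCorankBound` is,
binder for binder, `∀ (W, p, N, f), kato_selmerCorank_le_order_padicLFunction W p` (K. Kato,
Astérisque 295 (2004), Thm 18.4, p. 281, Selmer-corank form, vendored in `KatoRankBound.lean`):
both directions are re-orderings of the hypotheses `p ≠ 2`, `IsOrdinaryAt W p`, `IsNewformOf W f`.
[cite: Kato2004, Thm 18.4 (p. 281)] -/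
theorem leadingTerm_katoCorankBound_iff_forall_kato_selmerCorank_le_order_padicLFunction :
    KatoCorankBound ↔
      ∀ (W : WeierstrassCurve ℚ) [W.IsElliptic] [W.IsGloballyMinimal] (p : ℕ) [Fact p.Prime]
        {N : ℕ} [NeZero N] (f : CuspForm (Gamma0 N) 2),
        kato_selmerCorank_le_order_padicLFunction W p (f := f) :=
  ⟨fun h W _ _ p _ _ _ f hp hord hf => h W p hp hord f hf,
    fun h W _ _ p _ hp hord _ _ f hf => h W p f hp hord hf⟩

/-- **`KatoCorankBound` from the Literature named fact `kato_divisibility`** (K. Kato, Astérisque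
295 (2004), Thm 17.4, p. 273, all three clauses, quantified over all cyclotomic data): the
∀-closure over `(W, p, κ, γ, N, f)` of `kato_divisibility` gives, for each `(W, p, f)`, the named
fact `kato_selmerCorank_le_order_padicLFunction W p` by the tree theorem
`kato_selmerCorank_le_order_padicLFunction_of_kato_divisibility` (file `KatoRankBoundSelmerProofs`),
whose body is the item's. (Clause (3), the integral refinement, is not used; cf.
`leadingTerm_katoCorankBound_of_katoDivisibility`.) CONDITIONAL on the named fact.
[cite: Kato2004, Thm 17.4 (p. 273) and Thm 18.4 (p. 281)] -/
theorem leadingTerm_katoCorankBound_of_kato_divisibility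
    (h : ∀ (W : WeierstrassCurve ℚ) [W.IsElliptic] [W.IsGloballyMinimal] (p : ℕ) [Fact p.Prime]
      (κ : ZpExtension ℚ p) (γ : Field.absoluteGaloisGroup ℚ) {N : ℕ} [NeZero N]
      (f : CuspForm (Gamma0 N) 2), kato_divisibility W p (κ := κ) (γ := γ) (f := f)) :
    KatoCorankBound :=
  leadingTerm_katoCorankBound_iff_forall_kato_selmerCorank_le_order_padicLFunction.mpr
    fun W _ _ p _ _ _ f =>
      kato_selmerCorank_le_order_padicLFunction_of_kato_divisibility W p fun κ γ => h W p κ γ f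

/-- **`KatoCorankBound` implies the rank form `PAdicOrderKatoSideR2`** (stmt-BirchSwinnertonDyer-0491;
K. Kato, Astérisque 295 (2004), Thm 18.4, p. 281, "In particular, if `k = 2`, `K = ℚ`, and `f`
corresponds to an elliptic curve `E` over `ℚ`, we have `rank(E(ℚ)) ≤ ord_{s=1}(L_{p-adic,α}(f))` if
`E` is not a Tate curve"): `rank E(ℚ) ≤ corank_{ℤ_p} Sel_{p^∞}(E/ℚ) ≤ ord_{T=0} L_p`, the first
inequality by the PROVED Kummer corank identity `corank Sel_{p^∞}(E/ℚ) = rank E(ℚ) + corank Ш[p^∞]`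
(`WeierstrassCurve.selmerCorank_eq_mordellWeilRank_add_holds`), packaged by the tree theorem
`kato_mordellWeilRank_le_order_padicLFunction_of_selmerCorank`. Unconditional implication between
the two route decls: one proof of Kato 17.4 serves both Kato items of route LeadingTerm.
[cite: Kato2004, Thm 18.4 (p. 281)] -/
theorem leadingTerm_padicOrderKatoSideR2_of_katoCorankBound (h : KatoCorankBound) :
    PAdicOrderKatoSideR2 := by
  intro W _ _ p _ hp hord N _ f hf
  exact kato_mordellWeilRank_le_order_padicLFunction_of_selmerCorank W p
    (fun hp' hord' hf' => h W p hp' hord' f hf') W.selmerCorank_eq_mordellWeilRank_add_holds hp hord hf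

end Summit.BirchSwinnertonDyer.BirchSwinnertonDyer.Theorems
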